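import Literature.Geometry.Lorentzian.BogovskiiScalarGluing
import Literature.Geometry.Lorentzian.BogovskiiVectorL1Bound
import HarnessLib

/-!
# An `L¹ → L¹` bound for the glued smooth solutions of `div w = h` on a fixed spherical shell

(trunk G08 = T-LORENTZ; family `gr`; namespace `Literature.Geometry.Lorentzian.MaoOhTao`.)

`BogovskiiScalarGluing.lean` solves `div w = h` with `w ∈ C_c^∞({a < |x| < b})` for `h ∈ C_c^∞({a < |x| < b})`,
`∫ h = 0` (Galdi, III.3, Theorem III.3.3; Bogovskiĭ's formula on balls, glued along a finite chain of balls covering the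
closed shell spanned by `tsupp h`).  This file threads the order-`0` size bound through the same construction: on the
cells `‖SV_ζ h‖_{L¹} ≤ C_cell ‖h‖_{L¹}` (`BogovskiiVectorL1Bound.lean`), in the gluing step the pieces
`h_k = h χ_k − (∫ h χ_k) θ` satisfy `‖h_k‖_{L¹} ≤ 2 ‖h‖_{L¹}` (`0 ≤ χ_k ≤ 1`, `θ ≥ 0`, `∫ θ = 1`, the bump `θ` FIXED by the two
sets), so the union has constant `2 (C₁ + C₂)`, and the recursion over the finite cover
(`prop_biUnion_finset_of_isPreconnected`) applies verbatim to the quantitative property.  Result: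

* `exists_l1Const_divInverse_of_starConvex` — bounded cells star-shaped with respect to a ball;
* `exists_l1Const_divInverse_union` — the gluing step with constants;
* `exists_l1Const_divInverse_shell` — **for `0 < a < a'` and `b' < b` there is `C < ∞` such that every `h ∈ C_c^∞` with
  `tsupp h ⊆ {a' ≤ |x| ≤ b'}` and `∫ h = 0` is `Σ_i ∂_i w^i` for a smooth `w` compactly supported in `{a < |x| < b}` with
  `∫ |w^i| ≤ C ∫ |h|`** (stated with `∫⁻ ‖·‖ₑ`).

Everything is proved; no definitions, no named facts.

## References

* G. P. Galdi, *An Introduction to the Mathematical Theory of the Navier–Stokes Equations. Steady-State Problems*,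
  2nd ed., Springer (2011), Lemma III.3.1–III.3.4, Theorem III.3.1, Theorem III.3.3 and (III.3.20) (key `Galdi2011`).
* Y. Mao, S.-J. Oh, T. Tao, arXiv:2308.13031 (2023), proof of Lemma 2.2, p. 9 (key `MaoOhTao2023`).
-/

noncomputable section

open scoped RealInnerProductSpace Topology ContDiff Manifold ENNReal
open Filter MeasureTheory Set Metric Function

namespace Literature.Geometry.Lorentzian

namespace MaoOhTao

/-! ### Cells -/

section Cell

/-- **Bounded star-shaped cells, with the `L¹` bound**: if `Ω ⊆ B̄_ρ` is star-shaped with respect to every point of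
`ball c r`, there is `C < ∞` such that every `h ∈ C_c^∞` with `tsupp h ⊆ Ω`, `∫ h = 0` is `Σ_a ∂ₐ w^a` for the smooth
field `w = SV_ζ h` compactly supported inside `Ω`, with `∫⁻ ‖w^a‖ₑ ≤ C ∫⁻ ‖h‖ₑ`. [cite: Galdi2011, Lemma III.3.1] -/
theorem exists_l1Const_divInverse_of_starConvex {Ω : Set E3} {c : E3} {r ρ : ℝ} (hr : 0 < r)
    (hΩ : ∀ b ∈ ball c r, StarConvex ℝ b Ω) (hΩρ : Ω ⊆ closedBall (0 : E3) ρ) :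
    ∃ C : ℝ≥0∞, C < ⊤ ∧ ∀ h : E3 → ℝ, ContDiff ℝ ∞ h → HasCompactSupport h → tsupport h ⊆ Ω → ∫ x, h x = 0 →
      ∃ w : Fin 3 → E3 → ℝ, (∀ a, ContDiff ℝ ∞ (w a)) ∧ (∀ a, HasCompactSupport (w a)) ∧
        (∀ a, tsupport (w a) ⊆ Ω) ∧ (∀ x, ∑ a, pd a (w a) x = h x) ∧
        ∀ a, ∫⁻ x, ‖w a x‖ₑ ≤ C * ∫⁻ x, ‖h x‖ₑ := by
  -- the normalised bump `ζ` of `ball c (r/2)` (fixed by the cell)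
  let bmp : ContDiffBump c := ⟨r / 4, r / 2, by positivity, by linarith⟩
  set ζ : E3 → ℝ := bmp.normed volume with hζdef
  have hζ : ContDiff ℝ ∞ ζ := bmp.contDiff_normed
  have hζ1 : ∫ z : E3, ζ z = 1 := bmp.integral_normed
  have hζB : ∀ z, ζ z ≠ 0 → z ∈ closedBall c (r / 2) := fun z hz ↦ by
    have : z ∈ support ζ := mem_support.2 hz
    rw [hζdef, bmp.support_normed_eq] at this
    exact ball_subset_closedBall this
  have hR : ∀ z : E3, ‖c‖ + r < ‖z‖ → ζ z = 0 := by
    intro z hz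
    by_contra hne
    have hzB := hζB z hne
    rw [mem_closedBall, dist_eq_norm] at hzB
    have : ‖z‖ ≤ ‖z - c‖ + ‖c‖ := norm_le_norm_sub_add z c
    linarith
  obtain ⟨C, hC, hbound⟩ := exists_l1Const_bogovskiiSV hζ.continuous hR ρ
  refine ⟨C, hC, fun h hh hhc hhΩ hh0 ↦ ?_⟩
  -- the compact set carrying the solution
  set K : Set E3 := ⋃ y ∈ tsupport h, convexJoin ℝ (closedBall c (r / 2)) {y} with hKdef
  have hKB : ∀ b ∈ closedBall c (r / 2), StarConvex ℝ b K := fun b hb ↦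
    starConvex_iUnion_convexJoin_singleton (convex_closedBall c _) _ hb
  have hKc : IsCompact K := isCompact_iUnion_convexJoin_singleton (isCompact_closedBall c _) hhc
  have hKΩ : K ⊆ Ω :=
    iUnion_convexJoin_singleton_subset (fun b hb ↦ hΩ b (closedBall_subset_ball (by linarith) hb)) hhΩ
  have hhK : ∀ y, h y ≠ 0 → y ∈ K := fun y hy ↦
    subset_iUnion_convexJoin_singleton ⟨c, mem_closedBall_self (by positivity)⟩ _
      (subset_tsupport h (mem_support.2 hy))
  have hsupp : ∀ a, support (bogovskiiSV ζ h a) ⊆ K := fun a ↦ support_bogovskiiSV_subset hKB hζB hhK a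
  have hhρ : ∀ y, h y ≠ 0 → ‖y‖ ≤ ρ := fun y hy ↦
    mem_closedBall_zero_iff.1 (hΩρ (hhΩ (subset_tsupport h (mem_support.2 hy))))
  refine ⟨fun a ↦ bogovskiiSV ζ h a, fun a ↦ ?_, fun a ↦ ?_, fun a ↦ ?_, fun x ↦ ?_, fun a ↦ ?_⟩
  · exact contDiff_infty_bogovskiiVOperator hζ hR hh hhc a
  · exact HasCompactSupport.intro hKc fun x hx ↦ notMem_support.1 fun hx' ↦ hx (hsupp a hx')
  · exact (closure_minimal (hsupp a) hKc.isClosed).trans hKΩ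
  · exact sum_pd_bogovskiiSV_eq_self (hζ.of_le (by norm_cast)) hR hζ1 (hh.of_le (by norm_cast)) hhc hh0 x
  · exact hbound h hh.continuous hhρ a

end Cell

/-! ### The gluing step with constants -/

section Union

/-- **`L¹` size of a mass-corrected piece**: for `0 ≤ χ ≤ 1`, `θ ≥ 0` with `∫ θ = 1`,
`∫⁻ ‖h χ − (∫ h χ) θ‖ₑ ≤ 2 ∫⁻ ‖h‖ₑ`. [folklore] -/
theorem lintegral_enorm_massFree_piece_le {h χ θ : E3 → ℝ} (hh : Continuous h)
    (hχ0 : ∀ x, 0 ≤ χ x) (hχ1 : ∀ x, χ x ≤ 1) (hθ : Continuous θ) (hθc : HasCompactSupport θ) (hθ0 : ∀ x, 0 ≤ θ x)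
    (hθ1 : ∫ x, θ x = 1) :
    ∫⁻ x, ‖h x * χ x - (∫ y, h y * χ y) * θ x‖ₑ ≤ 2 * ∫⁻ x, ‖h x‖ₑ := by
  have hm1 : Measurable fun x ↦ ‖h x‖ₑ := hh.measurable.enorm
  -- `∫⁻ ‖θ‖ₑ = 1`
  have hθint : ∫⁻ x, ‖θ x‖ₑ = 1 := by
    have e : ∀ x, ‖θ x‖ₑ = ENNReal.ofReal (θ x) := fun x ↦ Real.enorm_eq_ofReal (hθ0 x)
    simp only [e]
    rw [← ofReal_integral_eq_lintegral_ofReal (hθ.integrable_of_hasCompactSupport hθc) (ae_of_all _ hθ0), hθ1,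
      ENNReal.ofReal_one]
  -- `‖∫ h χ‖ₑ ≤ ∫⁻ ‖h‖ₑ`
  have hmass : ‖∫ y, h y * χ y‖ₑ ≤ ∫⁻ y, ‖h y‖ₑ := by
    refine (enorm_integral_le_lintegral_enorm _).trans (lintegral_mono fun y ↦ ?_)
    rw [enorm_mul]
    calc ‖h y‖ₑ * ‖χ y‖ₑ ≤ ‖h y‖ₑ * 1 := by
          gcongr
          rw [Real.enorm_eq_ofReal (hχ0 y), ← ENNReal.ofReal_one]
          exact ENNReal.ofReal_le_ofReal (hχ1 y)
      _ = ‖h y‖ₑ := mul_one _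
  calc ∫⁻ x, ‖h x * χ x - (∫ y, h y * χ y) * θ x‖ₑ
      ≤ ∫⁻ x, (‖h x‖ₑ + ‖∫ y, h y * χ y‖ₑ * ‖θ x‖ₑ) := by
        refine lintegral_mono fun x ↦ (enorm_sub_le).trans ?_
        rw [enorm_mul, enorm_mul]
        gcongr
        calc ‖h x‖ₑ * ‖χ x‖ₑ ≤ ‖h x‖ₑ * 1 := by
              gcongr
              rw [Real.enorm_eq_ofReal (hχ0 x), ← ENNReal.ofReal_one]
              exact ENNReal.ofReal_le_ofReal (hχ1 x)
          _ = ‖h x‖ₑ := mul_one _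
    _ = (∫⁻ x, ‖h x‖ₑ) + ‖∫ y, h y * χ y‖ₑ * ∫⁻ x, ‖θ x‖ₑ := by
        rw [lintegral_add_left hm1, lintegral_const_mul _ hθ.measurable.enorm]
    _ ≤ (∫⁻ x, ‖h x‖ₑ) + (∫⁻ x, ‖h x‖ₑ) * 1 := by rw [hθint]; gcongr
    _ = 2 * ∫⁻ x, ‖h x‖ₑ := by rw [mul_one, two_mul]

/-- **The gluing step with constants.** If on `U_k` (open, with a common point) every admissible `h` has a smooth
compactly supported solution with `∫⁻ ‖w^a‖ₑ ≤ C_k ∫⁻ ‖h‖ₑ`, then on `U₁ ∪ U₂` the same holds with the constant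
`2 (C₁ + C₂)` (split `h = h₁ + h₂` as in `exists_smooth_divInverse_union`; `‖h_k‖₁ ≤ 2 ‖h‖₁`).
[cite: Galdi2011, Lemma III.3.2] -/
theorem exists_l1Const_divInverse_union {U₁ U₂ : Set E3} (hU₁ : IsOpen U₁) (hU₂ : IsOpen U₂) {p : E3}
    (hp₁ : p ∈ U₁) (hp₂ : p ∈ U₂) {C₁ C₂ : ℝ≥0∞}
    (h₁ : ∀ h : E3 → ℝ, ContDiff ℝ ∞ h → HasCompactSupport h → tsupport h ⊆ U₁ → ∫ x, h x = 0 →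
      ∃ w : Fin 3 → E3 → ℝ, (∀ a, ContDiff ℝ ∞ (w a)) ∧ (∀ a, HasCompactSupport (w a)) ∧
        (∀ a, tsupport (w a) ⊆ U₁) ∧ (∀ x, ∑ a, pd a (w a) x = h x) ∧ ∀ a, ∫⁻ x, ‖w a x‖ₑ ≤ C₁ * ∫⁻ x, ‖h x‖ₑ)
    (h₂ : ∀ h : E3 → ℝ, ContDiff ℝ ∞ h → HasCompactSupport h → tsupport h ⊆ U₂ → ∫ x, h x = 0 →
      ∃ w : Fin 3 → E3 → ℝ, (∀ a, ContDiff ℝ ∞ (w a)) ∧ (∀ a, HasCompactSupport (w a)) ∧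
        (∀ a, tsupport (w a) ⊆ U₂) ∧ (∀ x, ∑ a, pd a (w a) x = h x) ∧ ∀ a, ∫⁻ x, ‖w a x‖ₑ ≤ C₂ * ∫⁻ x, ‖h x‖ₑ)
    (h : E3 → ℝ) (hh : ContDiff ℝ ∞ h) (hhc : HasCompactSupport h) (hhU : tsupport h ⊆ U₁ ∪ U₂)
    (hh0 : ∫ x, h x = 0) :
    ∃ w : Fin 3 → E3 → ℝ, (∀ a, ContDiff ℝ ∞ (w a)) ∧ (∀ a, HasCompactSupport (w a)) ∧
      (∀ a, tsupport (w a) ⊆ U₁ ∪ U₂) ∧ (∀ x, ∑ a, pd a (w a) x = h x) ∧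
      ∀ a, ∫⁻ x, ‖w a x‖ₑ ≤ 2 * (C₁ + C₂) * ∫⁻ x, ‖h x‖ₑ := by
  -- the normalised bump `θ` at `p`, supported in `U₁ ∩ U₂`
  obtain ⟨ε, hε, hball⟩ := Metric.isOpen_iff.1 (hU₁.inter hU₂) p ⟨hp₁, hp₂⟩
  let b : ContDiffBump p := ⟨ε / 4, ε / 2, by positivity, by linarith⟩
  set θ : E3 → ℝ := b.normed volume with hθdef
  have hθ : ContDiff ℝ ∞ θ := b.contDiff_normed
  have hθc : HasCompactSupport θ := b.hasCompactSupport_normed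
  have hθ1 : ∫ x, θ x = 1 := b.integral_normed
  have hθ0 : ∀ x, 0 ≤ θ x := fun x ↦ b.nonneg_normed x
  have hθU : tsupport θ ⊆ U₁ ∩ U₂ := by
    rw [hθdef, b.tsupport_normed_eq]
    exact (closedBall_subset_ball (by show ε / 2 < ε; linarith)).trans hball
  -- a smooth partition of unity on `tsupp h` subordinate to `{U₁, U₂}`
  let V : Bool → Set E3 := fun c ↦ cond c U₁ U₂
  have hVo : ∀ c, IsOpen (V c) := fun c ↦ by cases c <;> assumption
  have hfV : tsupport h ⊆ ⋃ c, V c := by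
    intro x hx
    rcases hhU hx with hx' | hx'
    · exact mem_iUnion.2 ⟨true, hx'⟩
    · exact mem_iUnion.2 ⟨false, hx'⟩
  obtain ⟨ρ, hρ⟩ := SmoothPartitionOfUnity.exists_isSubordinate (I := 𝓘(ℝ, E3)) (isClosed_tsupport h) V hVo hfV
  set χ₁ : E3 → ℝ := fun x ↦ ρ true x with hχ₁def
  set χ₂ : E3 → ℝ := fun x ↦ ρ false x with hχ₂def
  have hχ₁ : ContDiff ℝ ∞ χ₁ := contMDiff_iff_contDiff.1 (ρ true).contMDiff
  have hχ₂ : ContDiff ℝ ∞ χ₂ := contMDiff_iff_contDiff.1 (ρ false).contMDiff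
  have hχ₁U : tsupport χ₁ ⊆ U₁ := hρ true
  have hχ₂U : tsupport χ₂ ⊆ U₂ := hρ false
  have hsum : ∀ x, h x ≠ 0 → χ₁ x + χ₂ x = 1 := by
    intro x hx
    have hs := ρ.sum_eq_one (subset_tsupport h (mem_support.2 hx))
    rw [finsum_eq_sum_of_fintype, Fintype.sum_bool] at hs
    exact hs
  -- the two pieces and their sizes
  obtain ⟨c₁, s₁, t₁, m₁⟩ := smooth_massFree_piece hh hhc hχ₁ hθ hθc hθ1
  obtain ⟨c₂, s₂, t₂, m₂⟩ := smooth_massFree_piece hh hhc hχ₂ hθ hθc hθ1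
  have l₁ := lintegral_enorm_massFree_piece_le hh.continuous (fun x ↦ ρ.nonneg true x)
    (fun x ↦ ρ.le_one true x) hθ.continuous hθc hθ0 hθ1
  have l₂ := lintegral_enorm_massFree_piece_le hh.continuous (fun x ↦ ρ.nonneg false x)
    (fun x ↦ ρ.le_one false x) hθ.continuous hθc hθ0 hθ1
  obtain ⟨w₁, hw₁, hw₁c, hw₁U, hw₁d, hw₁b⟩ := h₁ _ c₁ s₁
    (t₁.trans (union_subset hχ₁U (hθU.trans inter_subset_left))) m₁
  obtain ⟨w₂, hw₂, hw₂c, hw₂U, hw₂d, hw₂b⟩ := h₂ _ c₂ s₂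
    (t₂.trans (union_subset hχ₂U (hθU.trans inter_subset_right))) m₂
  refine ⟨fun a x ↦ w₁ a x + w₂ a x, fun a ↦ (hw₁ a).add (hw₂ a), fun a ↦ (hw₁c a).add (hw₂c a), fun a ↦
    (tsupport_add (w₁ a) (w₂ a)).trans (union_subset_union (hw₁U a) (hw₂U a)), fun x ↦ ?_, fun a ↦ ?_⟩
  · -- the divergence of the sum
    have hpd : ∀ a, pd a (fun x ↦ w₁ a x + w₂ a x) x = pd a (w₁ a) x + pd a (w₂ a) x := fun a ↦
      pd_add ((hw₁ a).differentiable (by simp) x) ((hw₂ a).differentiable (by simp) x)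
    simp only [hpd, Finset.sum_add_distrib, hw₁d, hw₂d]
    have hpt : ∀ y, h y * χ₁ y + h y * χ₂ y = h y := by
      intro y
      by_cases hy : h y = 0
      · simp [hy]
      · rw [← mul_add, hsum y hy, mul_one]
    have I : ∀ χ : E3 → ℝ, ContDiff ℝ ∞ χ → Integrable fun y ↦ h y * χ y := fun χ hχ ↦
      (hh.continuous.mul hχ.continuous).integrable_of_hasCompactSupport hhc.mul_right
    have hint : (∫ y, h y * χ₁ y) + ∫ y, h y * χ₂ y = 0 := by
      rw [← integral_add (I χ₁ hχ₁) (I χ₂ hχ₂), ← hh0]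
      exact integral_congr_ae (ae_of_all _ fun y ↦ hpt y)
    calc h x * χ₁ x - (∫ y, h y * χ₁ y) * θ x + (h x * χ₂ x - (∫ y, h y * χ₂ y) * θ x)
        = (h x * χ₁ x + h x * χ₂ x) - ((∫ y, h y * χ₁ y) + ∫ y, h y * χ₂ y) * θ x := by ring
      _ = h x := by rw [hpt x, hint, zero_mul, sub_zero]
  · -- the `L¹` bound
    have hm : Measurable fun x ↦ ‖w₁ a x‖ₑ := (hw₁ a).continuous.measurable.enorm
    calc ∫⁻ x, ‖w₁ a x + w₂ a x‖ₑ ≤ ∫⁻ x, (‖w₁ a x‖ₑ + ‖w₂ a x‖ₑ) := lintegral_mono fun x ↦ enorm_add_le _ _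
      _ = (∫⁻ x, ‖w₁ a x‖ₑ) + ∫⁻ x, ‖w₂ a x‖ₑ := lintegral_add_left hm _
      _ ≤ C₁ * (2 * ∫⁻ x, ‖h x‖ₑ) + C₂ * (2 * ∫⁻ x, ‖h x‖ₑ) :=
          add_le_add ((hw₁b a).trans (by gcongr)) ((hw₂b a).trans (by gcongr))
      _ = 2 * (C₁ + C₂) * ∫⁻ x, ‖h x‖ₑ := by ring

end Union

/-! ### The fixed shell -/

section Shell

/-- **`L¹ → L¹` bound for the glued inverse on a fixed shell.**  For `0 < a < a'` and `b' < b` there is `C < ∞` such that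
every `h ∈ C_c^∞(ℝ³)` with `tsupp h ⊆ {a' ≤ |x| ≤ b'}` and `∫ h = 0` is `Σ_i ∂_i w^i` for a smooth field `w` with compact
support, `tsupp w^i ⊆ {a < |x| < b}`, and `∫⁻ ‖w^i‖ₑ ≤ C ∫⁻ ‖h‖ₑ`: one finite cover of the closed shell by balls of radius
`min (a' − a) (b − b')`, the cell constants of `exists_l1Const_divInverse_of_starConvex`, and the recursion
`prop_biUnion_finset_of_isPreconnected` for the quantitative property. [cite: Galdi2011, Theorem III.3.3] -/
theorem exists_l1Const_divInverse_shell {a a' b' b : ℝ} (ha : 0 < a) (haa' : a < a') (hb'b : b' < b) :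
    ∃ C : ℝ≥0∞, C < ⊤ ∧ ∀ h : E3 → ℝ, ContDiff ℝ ∞ h → HasCompactSupport h →
      tsupport h ⊆ {x : E3 | a' ≤ ‖x‖ ∧ ‖x‖ ≤ b'} → ∫ x, h x = 0 →
      ∃ w : Fin 3 → E3 → ℝ, (∀ i, ContDiff ℝ ∞ (w i)) ∧ (∀ i, HasCompactSupport (w i)) ∧
        (∀ i, tsupport (w i) ⊆ {x : E3 | a < ‖x‖ ∧ ‖x‖ < b}) ∧ (∀ x, ∑ i, pd i (w i) x = h x) ∧
        ∀ i, ∫⁻ x, ‖w i x‖ₑ ≤ C * ∫⁻ x, ‖h x‖ₑ := by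
  set K : Set E3 := {x | a' ≤ ‖x‖ ∧ ‖x‖ ≤ b'} with hKdef
  -- the trivial answer for `h = 0`
  have hzero : ∀ (C : ℝ≥0∞) (h : E3 → ℝ), h = 0 →
      ∃ w : Fin 3 → E3 → ℝ, (∀ i, ContDiff ℝ ∞ (w i)) ∧ (∀ i, HasCompactSupport (w i)) ∧
        (∀ i, tsupport (w i) ⊆ {x : E3 | a < ‖x‖ ∧ ‖x‖ < b}) ∧ (∀ x, ∑ i, pd i (w i) x = h x) ∧
        ∀ i, ∫⁻ x, ‖w i x‖ₑ ≤ C * ∫⁻ x, ‖h x‖ₑ := by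
    intro C h h0
    have ht0 : tsupport (fun _ : E3 ↦ (0 : ℝ)) = ∅ := tsupport_eq_empty_iff.2 rfl
    refine ⟨fun _ _ ↦ 0, fun _ ↦ contDiff_const, fun _ ↦ HasCompactSupport.zero, fun i ↦ ?_, fun x ↦ ?_, fun i ↦ ?_⟩
    · rw [ht0]
      exact empty_subset _
    · simp [pd, h0]
    · simp
  by_cases hK : K.Nonempty
  swap
  · -- empty shell: only `h = 0` is admissible
    refine ⟨0, ENNReal.zero_lt_top, fun h _ _ hhK _ ↦ hzero 0 h ?_⟩
    exact tsupport_eq_empty_iff.1 (subset_eq_empty hhK (not_nonempty_iff_eq_empty.1 hK))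
  -- the cover of the closed shell by balls
  have ha' : 0 < a' := ha.trans haa'
  have hKc : IsCompact K := (isCompact_closedBall (0 : E3) b').of_isClosed_subset
    ((isClosed_le continuous_const continuous_norm).inter (isClosed_le continuous_norm continuous_const))
    fun _ hx ↦ mem_closedBall_zero_iff.2 hx.2
  have hKconn : IsPreconnected K := isPreconnected_closedShell ha'
  set δ : ℝ := min (a' - a) (b - b') with hδdef
  have hδ : 0 < δ := lt_min (by linarith) (by linarith)
  have hδ1 : δ ≤ a' - a := min_le_left _ _
  have hδ2 : δ ≤ b - b' := min_le_right _ _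
  have hballU : ∀ q ∈ K, ball q δ ⊆ {x : E3 | a < ‖x‖ ∧ ‖x‖ < b} := by
    intro q hq y hy
    rw [mem_ball, dist_eq_norm] at hy
    have h1 : ‖q‖ ≤ ‖y‖ + ‖y - q‖ := by
      have := norm_add_le y (q - y)
      rwa [add_sub_cancel, ← norm_neg (q - y), neg_sub] at this
    have h2 : ‖y‖ ≤ ‖q‖ + ‖y - q‖ := norm_le_insert' y q
    exact ⟨by linarith [hq.1], by linarith [hq.2]⟩
  have hballρ : ∀ q ∈ K, ball q δ ⊆ closedBall (0 : E3) b := fun q hq y hy ↦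
    mem_closedBall_zero_iff.2 (hballU q hq hy).2.le
  obtain ⟨t, ht⟩ := hKc.elim_finite_subcover (fun q : K ↦ ball (q : E3) δ) (fun _ ↦ isOpen_ball)
    fun x hx ↦ mem_iUnion.2 ⟨⟨x, hx⟩, mem_ball_self hδ⟩
  -- the recursion for the quantitative property
  have hcover := prop_biUnion_finset_of_isPreconnected
    (P := fun U : Set E3 ↦ ∃ C : ℝ≥0∞, C < ⊤ ∧ ∀ g : E3 → ℝ, ContDiff ℝ ∞ g → HasCompactSupport g →
      tsupport g ⊆ U → ∫ x, g x = 0 →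
      ∃ w : Fin 3 → E3 → ℝ, (∀ i, ContDiff ℝ ∞ (w i)) ∧ (∀ i, HasCompactSupport (w i)) ∧
        (∀ i, tsupport (w i) ⊆ U) ∧ (∀ x, ∑ i, pd i (w i) x = g x) ∧ ∀ i, ∫⁻ x, ‖w i x‖ₑ ≤ C * ∫⁻ x, ‖g x‖ₑ)
    (fun U₁ U₂ hU₁ hU₂ hne' hP₁ hP₂ ↦ by
      obtain ⟨p, hp₁, hp₂⟩ := hne'
      obtain ⟨C₁, hC₁, hP₁⟩ := hP₁
      obtain ⟨C₂, hC₂, hP₂⟩ := hP₂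
      refine ⟨2 * (C₁ + C₂), ?_, exists_l1Const_divInverse_union hU₁ hU₂ hp₁ hp₂ hP₁ hP₂⟩
      exact ENNReal.mul_lt_top (by simp) (ENNReal.add_lt_top.2 ⟨hC₁, hC₂⟩))
    hKconn t (fun q : K ↦ ball (q : E3) δ) (fun q _ ↦ isOpen_ball)
    (fun q _ ↦ exists_l1Const_divInverse_of_starConvex (Ω := ball (q : E3) δ) (c := (q : E3)) hδ
      (fun b' hb' ↦ (convex_ball _ _).starConvex hb') (hballρ q q.2)) ht
    (fun q _ ↦ ⟨q, mem_ball_self hδ, q.2⟩)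
    (by
      obtain ⟨x₀, hx₀⟩ := hK
      obtain ⟨q, hq, _⟩ := mem_iUnion₂.1 (ht hx₀)
      exact ⟨q, hq⟩)
  obtain ⟨C, hC, hsolve⟩ := hcover
  refine ⟨C, hC, fun h hh hhc hhK hh0 ↦ ?_⟩
  obtain ⟨w, hw, hwc, hwU, hwd, hwb⟩ := hsolve h hh hhc (hhK.trans ht) hh0
  exact ⟨w, hw, hwc, fun i ↦ (hwU i).trans (iUnion₂_subset fun q _ ↦ hballU q q.2), hwd, hwb⟩

end Shell

end MaoOhTao

end Literature.Geometry.Lorentzian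

end
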